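import Literature.NumberTheory.LFunctions.EisensteinGrossencharacterSums
import Literature.NumberTheory.NumberFields.EisensteinFieldPrimes
import Literature.NumberTheory.LFunctions.IdealCharacterPNT
import Literature.NumberTheory.GaloisRepresentations.CubicReciprocityRationalPrime
import HarnessLib

/-!
# The Euler product of `L(s, ν_{d,r,m})` over the RATIONAL primes and its local factors at bad,
# inert and split primes

Topic `NumberTheory/LFunctions`; namespace `Literature.NumberTheory.LFunctions.EisensteinGrossen`;
sequel to `EisensteinGrossencharacterSums` (the characters `ν = grossenNu D r m` of `K3 = ℚ(ζ₃)`) and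
`NumberFields/EisensteinFieldPrimes` (splitting of rational primes in `𝓞 K3`). Definitions with bodies
(`underPrime`, `underP`, `primesOver`, `primeOf`, `tau`, `conjPrime`, `localFactor`) and theorems; no
named fact (D-0026). Filed in support of the named fact `murty_petersson_newform_lower_bound`: the
comparison `L(Sym² f_E, s) = L(s, χ₋₃) L(s, ν_E) E(s)` for the `j = 0` CM family is made prime by
prime over the RATIONAL primes (Ireland–Rosen Ch. 18 §6, proof of Thm. 7), which needs

* `hasProd_primes_LSeries_twistCount` — **`L(s, ν) = ∏_p ∏_{v ∣ p} (1 − ν(v)N(v)^{−s})⁻¹`**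
  (`Re s > 1`) for any `ν : Ideal(𝓞 K3) →*₀ ℂ` with `‖ν‖ ≤ 1`: the Euler product over the primes of
  `𝓞 K3` (`IdealCharacterPNT.hasProd_LSeries_twistCount`) regrouped along `v ↦ p(v) = char(𝓞 K3/v)`
  (`underPrime`, `underPrime_eq_iff`; `Equiv.sigmaFiberEquiv`, `HasProd.sigma`, finite fibres
  `primesOver p`); `hasProd_localFactor` for `ν_{d,r,m}`;
* the fibres: `primesOver_of_mod_three_eq_two = {(p)}`, `primesOver_of_norm_eq = {(ϖ), (ϖ̄)}`,
  `primesOver_three = {(λ)}`;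
* the values of `ν_{d,r,m}` (`d ∈ ℤ`) on them: `psi_asIdeal_eq` (`ψ_D(v) = e(χ_v(D))` for `v ∤ 3D`,
  cube and non-cube case alike), `grossenNu_asIdeal_eq`, `grossenNu_asIdeal_eq_zero_of_mem` (`3D ∈ v`),
  **`cubicResidueSymbol_inert_intCast`** (`χ_{(p)}(d) = 1` for `p ≡ 2 (3)` odd, `p ∤ d`:
  `d^{(p²−1)/3} = (d^{p−1})^{(p+1)/3}`), `primGen_span_natCast_of_mod_three_eq_two` (`ϖ_{(p)} = −p`),
  **`grossenNu_span_natCast_of_mod_three_eq_two`** (`ν((p)) = (−1)^m`);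
* **complex conjugation** `tau : 𝓞 K3 ≃+* 𝓞 K3` (`τ(a + bζ) = (a − b) − bζ`, `e ∘ τ = conj ∘ e`:
  `embC_tau`), the conjugate prime `conjPrime v = τ v` (`mem_conjPrime_iff`, `residueCard_conjPrime`),
  **`cubicResidueSymbol_conjPrime`** (`χ_{τv}(τx) = τ(χ_v(x))`, from the characterisation
  `cubicResidueSymbol_eq_of_pow_three_eq_one`), `primGen_map_tau`, and
  **`grossenNu_conjPrime`**: `ν_{d,r,m}(τ v) = conj ν_{d,r,m}(v)`;
* the local factors `localFactor d r m p s = ∏_{v ∣ p} (1 − ν(v)N(v)^{−s})⁻¹`: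
  `localFactor_of_dvd` (`= 1` for `p ∣ 3d`), `localFactor_of_mod_three_eq_two`
  (`= (1 − (−1)^m p^{−2s})⁻¹`), `exists_split_data` + `localFactor_of_split`
  (`= (1 − ν(v)p^{−s})⁻¹(1 − conj ν(v) p^{−s})⁻¹` with `v` of degree one, primary generator `ϖ`,
  `‖e(ϖ)‖² = p`, `ν(v) = e(χ_v(d))^r (e(ϖ)/|e(ϖ)|)^m`).

## References

* K. Ireland, M. Rosen, *A Classical Introduction to Modern Number Theory*, 2nd ed. (1990), Ch. 9 §1
  Prop. 9.1.4, §3 Prop. 9.3.3–9.3.4; Ch. 18 §6, proof of Theorem 7. [cite: IrelandRosen1990, Ch. 18 §6, proof of Theorem 7]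
* E. Hecke, Math. Z. 6 (1920), §6. [cite: HeckeMathZ1920, §6]

## Mathlib / tree search

Tree: `EisensteinGrossencharacterSums`, `EisensteinFieldPrimes`, `IdealCharacterPNT.hasProd_LSeries_twistCount`,
`CubicReciprocityRationalPrime.{charP_quotient_of_natCast_mem, natCast_pow_sub_one_eq_one}`,
`CubicResidueSymbol.{cubicResidueSymbol_spec, cubicResidueSymbol_eq_of_pow_three_eq_one, cubicResidueSymbol_zero}`,
`KummerCubicCharacterPeriodicity.{artinSymbol_kummerChar_asIdeal, cubicResidueSymbol_eq_one_of_cube}`,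
`EisensteinField.conj`. Mathlib: `ringChar`, `CharP.char_is_prime_of_pos`, `Ideal.finite_factors`,
`Equiv.sigmaFiberEquiv`, `HasProd.sigma`, `Fintype.subtype`, `Finset.prod_subtype`,
`RingOfIntegers.mapRingEquiv`, `Ideal.map_isPrime_of_equiv`, `Ideal.mem_map_of_equiv`,
`Ideal.quotientEquiv`, `QuadraticAlgebra.star_mk`, `Int.eq_nat_or_neg`, `Nat.Prime.even_sub_one`.
-/

noncomputable section

open NumberField IsDedekindDomain Complex Finset Filter Topology
open scoped ComplexConjugate

namespace Literature.NumberTheory.LFunctions.EisensteinGrossen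

open Literature.NumberTheory.NumberFields Literature.NumberTheory.NumberFields.K3
open Literature.NumberTheory.GaloisRepresentations
open LFunctions LFunctions.NumberField PlaneLattice

/-! ### The rational prime under a prime of `𝓞 K3` and the fibres -/

/-- The residue characteristic of a prime `v` of `𝓞 K3` (the rational prime under `v`). [folklore] -/
def underPrime (v : HeightOneSpectrum (𝓞 K3)) : ℕ := ringChar (𝓞 K3 ⧸ v.asIdeal)

/-- The residue characteristic is a prime. [folklore] -/
theorem underPrime_prime (v : HeightOneSpectrum (𝓞 K3)) : (underPrime v).Prime := by
  letI := Ideal.Quotient.field v.asIdeal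
  haveI : Finite (𝓞 K3 ⧸ v.asIdeal) := Ideal.finiteQuotientOfFreeOfNeBot _ v.ne_bot
  haveI : CharP (𝓞 K3 ⧸ v.asIdeal) (underPrime v) := ringChar.charP _
  haveI : NeZero (underPrime v) := ⟨CharP.char_ne_zero_of_finite (𝓞 K3 ⧸ v.asIdeal) _⟩
  exact (CharP.char_is_prime_of_pos (𝓞 K3 ⧸ v.asIdeal) (underPrime v)).out

/-- **`underPrime v = p ↔ p ∈ v`** for a rational prime `p`. [folklore] -/
theorem underPrime_eq_iff {v : HeightOneSpectrum (𝓞 K3)} {p : ℕ} (hp : p.Prime) :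
    underPrime v = p ↔ ((p : ℤ) : 𝓞 K3) ∈ v.asIdeal := by
  have hcast : ((p : ℤ) : 𝓞 K3) = (p : 𝓞 K3) := by push_cast; rfl
  rw [hcast]
  constructor
  · intro h
    have hspec := (ringChar.spec (𝓞 K3 ⧸ v.asIdeal) p).mpr (by rw [← underPrime, h])
    rwa [← map_natCast (Ideal.Quotient.mk v.asIdeal), Ideal.Quotient.eq_zero_iff_mem] at hspec
  · intro h
    haveI : Fact p.Prime := ⟨hp⟩
    haveI := charP_quotient_of_natCast_mem (K := K3) h
    exact ringChar.eq (𝓞 K3 ⧸ v.asIdeal) p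

/-- The rational prime under `v`, as an element of `Nat.Primes`. [folklore] -/
def underP (v : HeightOneSpectrum (𝓞 K3)) : Nat.Primes := ⟨underPrime v, underPrime_prime v⟩

/-- `(p) ≠ 0` in `𝓞 K3`. [folklore] -/
theorem span_natCast_ne_bot {p : ℕ} (hp : p.Prime) : Ideal.span {((p : ℤ) : 𝓞 K3)} ≠ ⊥ := by
  rw [Ne, Ideal.span_singleton_eq_bot, ← mkInt_intCast, mkInt_eq_zero_iff]
  simp [hp.ne_zero]

/-- **The primes above `p`** as a finite set. [folklore] -/
def primesOver (p : ℕ) : Finset (HeightOneSpectrum (𝓞 K3)) :=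
  if hp : p.Prime then (Ideal.finite_factors (span_natCast_ne_bot hp)).toFinset else ∅

/-- Membership: `v ∈ primesOver p ↔ p ∈ v`. [folklore] -/
theorem mem_primesOver {p : ℕ} (hp : p.Prime) {v : HeightOneSpectrum (𝓞 K3)} :
    v ∈ primesOver p ↔ ((p : ℤ) : 𝓞 K3) ∈ v.asIdeal := by
  rw [primesOver, dif_pos hp, Set.Finite.mem_toFinset, Set.mem_setOf_eq, Ideal.dvd_span_singleton]

/-- Membership via the residue characteristic. [folklore] -/
theorem mem_primesOver_iff_underP {p : Nat.Primes} {v : HeightOneSpectrum (𝓞 K3)} :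
    v ∈ primesOver p ↔ underP v = p := by
  rw [mem_primesOver p.2, ← underPrime_eq_iff p.2, ← Nat.Primes.coe_nat_inj]
  rfl

/-- **Regrouping an Euler product over the primes of `𝓞 K3` by the rational primes below**:
`∏_v f(v) = ∏_p ∏_{v ∣ p} f(v)` (unconditional convergence is preserved under the fibration).
[folklore] -/
theorem hasProd_primes_of_hasProd {f : HeightOneSpectrum (𝓞 K3) → ℂ} {a : ℂ} (hf : HasProd f a) :
    HasProd (fun p : Nat.Primes ↦ ∏ v ∈ primesOver p, f v) a := by
  classical
  have h1 : HasProd (f ∘ Equiv.sigmaFiberEquiv underP) a := (Equiv.hasProd_iff _).mpr hf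
  refine h1.sigma fun p ↦ ?_
  haveI : Fintype {v : HeightOneSpectrum (𝓞 K3) // underP v = p} :=
    Fintype.subtype (primesOver p) (fun v ↦ mem_primesOver_iff_underP)
  have h2 := hasProd_fintype (fun c : {v : HeightOneSpectrum (𝓞 K3) // underP v = p} ↦ f c.1)
  rw [← Finset.prod_subtype (primesOver p) (fun v ↦ mem_primesOver_iff_underP) f] at h2
  exact h2

/-- **`L(s, ν) = ∏_p ∏_{v ∣ p} (1 − ν(v) N(v)^{−s})⁻¹`** over the rational primes, `Re s > 1`.
[cite: IrelandRosen1990, Ch. 18 §6, proof of Theorem 7] -/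
theorem hasProd_primes_LSeries_twistCount (ν : Ideal (𝓞 K3) →*₀ ℂ) (hν : ∀ I, ‖ν I‖ ≤ 1)
    {s : ℂ} (hs : 1 < s.re) :
    HasProd (fun p : Nat.Primes ↦ ∏ v ∈ primesOver p,
      (1 - ν v.asIdeal * ((Ideal.absNorm v.asIdeal : ℕ) : ℂ) ^ (-s))⁻¹) (LSeries (twistCount K3 ν) s) :=
  hasProd_primes_of_hasProd (IdealCharPNT.hasProd_LSeries_twistCount ν hν hs)

/-! ### The fibres: inert, split, ramified -/

/-- The prime of `𝓞 K3` generated by a prime element. [folklore] -/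
def primeOf {q : 𝓞 K3} (hq : Prime q) : HeightOneSpectrum (𝓞 K3) :=
  ⟨Ideal.span {q}, (Ideal.span_singleton_prime hq.ne_zero).mpr hq,
    by rw [Ne, Ideal.span_singleton_eq_bot]; exact hq.ne_zero⟩

/-- Its underlying ideal. [folklore] -/
@[simp] theorem primeOf_asIdeal {q : 𝓞 K3} (hq : Prime q) : (primeOf hq).asIdeal = Ideal.span {q} := rfl

/-- **Inert fibre**: `primesOver p = {(p)}` for `p ≡ 2 (mod 3)`. [cite: IrelandRosen1990, Prop. 9.1.4] -/
theorem primesOver_of_mod_three_eq_two {p : ℕ} (hp : p.Prime) (hp3 : p % 3 = 2) :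
    primesOver p = {primeOf (prime_natCast_of_mod_three_eq_two hp hp3)} := by
  ext v
  rw [mem_primesOver hp, Finset.mem_singleton]
  constructor
  · intro h
    exact HeightOneSpectrum.ext (by rw [primeOf_asIdeal]; exact asIdeal_eq_of_mod_three_eq_two hp hp3 v h)
  · rintro rfl
    exact Ideal.mem_span_singleton_self _

open Classical in
/-- **Split fibre**: `primesOver p = {(ϖ), (ϖ̄)}` for `p = N(ϖ)`, `p ≡ 1 (mod 3)`, two distinct primes.
[cite: IrelandRosen1990, Prop. 9.1.4] -/
theorem primesOver_of_norm_eq {p : ℕ} (hp : p.Prime) {a b : ℤ} (h : a ^ 2 - a * b + b ^ 2 = p) :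
    primesOver p = {primeOf (prime_mkInt_of_norm_eq_prime hp h),
      primeOf (prime_mkInt_of_norm_eq_prime hp ((norm_conj_eq a b).trans h))} := by
  ext v
  rw [mem_primesOver hp, Finset.mem_insert, Finset.mem_singleton]
  constructor
  · intro hv
    rcases asIdeal_eq_or_of_norm_eq hp h v hv with h1 | h1
    · exact Or.inl (HeightOneSpectrum.ext (by rw [primeOf_asIdeal]; exact h1))
    · exact Or.inr (HeightOneSpectrum.ext (by rw [primeOf_asIdeal]; exact h1))
  · have hmem : ((p : ℤ) : 𝓞 K3) ∈ Ideal.span {mkInt a b} * Ideal.span {mkInt (a - b) (-b)} := by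
      rw [← span_natCast_eq_mul_conj h]; exact Ideal.mem_span_singleton_self _
    rintro (rfl | rfl)
    · exact Ideal.mul_le_right hmem
    · exact Ideal.mul_le_left hmem

/-- **Ramified fibre**: `primesOver 3 = {(λ)}`. [cite: IrelandRosen1990, Prop. 9.1.4] -/
theorem primesOver_three : primesOver 3 = {primeOf prime_lamInt} := by
  ext v
  rw [mem_primesOver Nat.prime_three, Finset.mem_singleton]
  have e3 : (((3 : ℕ) : ℤ) : 𝓞 K3) = 3 := by simp
  rw [e3]
  constructor
  · intro h
    refine HeightOneSpectrum.ext ?_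
    rw [primeOf_asIdeal]
    exact asIdeal_eq_of_three_mem v h
  · rintro rfl
    rw [primeOf_asIdeal, three_eq_neg_zetaInt_sq_mul_lamInt_sq, Ideal.neg_mem_iff, sq lamInt, ← mul_assoc]
    exact Ideal.mul_mem_left _ _ (Ideal.mem_span_singleton_self _)

/-! ### The symbol at a prime `v ∤ 3D` (cube and non-cube case uniformly) -/

section Values

variable (D : 𝓞 K3) (r m : ℕ)

/-- **`ψ_D(v) = e(χ_v(D))` for every prime `v ∤ 3D`** (non-cube case:
`artinSymbol_kummerChar_asIdeal`; cube case: both sides are `1`). [cite: IrelandRosen1990, Ch. 9 §3 Theorem 1] -/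
theorem psi_asIdeal_eq (v : HeightOneSpectrum (𝓞 K3)) (hDv : D ∉ v.asIdeal) (h3v : (3 : 𝓞 K3) ∉ v.asIdeal) :
    ((psi D v.asIdeal : ℂˣ) : ℂ) = embC ((cubicResidueSymbol v (Ideal.Quotient.mk v.asIdeal D) : 𝓞 K3) : K3) := by
  unfold psi psiLoc
  split_ifs with hD
  · haveI := isGalois_kummerField hζ hD
    exact artinSymbol_kummerChar_asIdeal hζ hD embC.toRingHom v hDv h3v
  · obtain ⟨b, hb⟩ := not_forall.mp hD
    have hb' : b ^ 3 = (D : K3) := not_not.mp hb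
    rw [artinSymbol_const_one, Units.val_one, cubicResidueSymbol_eq_one_of_cube hζ hb' v hDv h3v]
    simp

/-- **The value of `ν` at an admissible prime**: `ν(v) = e(χ_v(D))^r · (e(ϖ_v)/|e(ϖ_v)|)^m`.
[cite: HeckeMathZ1920, §6] -/
theorem grossenNu_asIdeal_eq (v : HeightOneSpectrum (𝓞 K3)) (hDv : D ∉ v.asIdeal)
    (h3v : (3 : 𝓞 K3) ∉ v.asIdeal) (hadm : Adm D v.asIdeal) :
    grossenNu D r m v.asIdeal =
      embC ((cubicResidueSymbol v (Ideal.Quotient.mk v.asIdeal D) : 𝓞 K3) : K3) ^ r *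
        sectorWeight m (embC (primGen v.asIdeal : K3)) := by
  rw [grossenNu_apply, if_pos hadm, psi_asIdeal_eq D v hDv h3v]

/-- A prime `v` with `3D ∉ v` is admissible. [folklore] -/
theorem adm_of_not_mem (v : HeightOneSpectrum (𝓞 K3)) (h : 3 * D ∉ v.asIdeal) : Adm D v.asIdeal := by
  refine ⟨v.ne_bot, ?_⟩
  rw [Ideal.isCoprime_iff_sup_eq]
  by_contra hne
  have hle : v.asIdeal ⊔ Ideal.span {3 * D} ≤ v.asIdeal :=
    (v.isMaximal.eq_of_le hne le_sup_left).ge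
  exact h (hle (Ideal.mem_sup_right (Ideal.mem_span_singleton_self _)))

/-- A prime `v` with `3D ∈ v` is NOT admissible, so `ν(v) = 0`. [folklore] -/
theorem grossenNu_asIdeal_eq_zero_of_mem (v : HeightOneSpectrum (𝓞 K3)) (h : 3 * D ∈ v.asIdeal) :
    grossenNu D r m v.asIdeal = 0 := by
  rw [grossenNu_apply, if_neg]
  rintro ⟨-, hcop⟩
  rw [Ideal.isCoprime_iff_sup_eq, sup_eq_left.mpr ((Ideal.span_singleton_le_iff_mem _).mpr h)] at hcop
  exact v.isPrime.ne_top hcop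

end Values

/-! ### Integer parameters `D ∈ ℤ`: inert primes -/

section IntParam

variable (d : ℤ) (r m : ℕ)

/-- For a rational prime `p` with `p ∈ v` and `p ∤ n` (integers), `n ∉ v`. [folklore] -/
theorem intCast_not_mem {v : HeightOneSpectrum (𝓞 K3)} {p : ℕ} (hp : p.Prime)
    (hpv : ((p : ℤ) : 𝓞 K3) ∈ v.asIdeal) {n : ℤ} (hn : ¬ (p : ℤ) ∣ n) : ((n : ℤ) : 𝓞 K3) ∉ v.asIdeal := by
  intro h
  have hcop : IsCoprime (p : ℤ) n :=
    (Nat.prime_iff_prime_int.mp hp).irreducible.coprime_iff_not_dvd.mpr hn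
  obtain ⟨a, b, hab⟩ := hcop
  rw [Int.cast_natCast] at hpv
  have e : (a : 𝓞 K3) * (p : 𝓞 K3) + (b : 𝓞 K3) * (n : 𝓞 K3) = 1 := by
    have h' := congrArg (Int.cast : ℤ → 𝓞 K3) hab
    push_cast at h'
    exact h'
  have h1 : (1 : 𝓞 K3) ∈ v.asIdeal := by
    rw [← e]
    exact v.asIdeal.add_mem (v.asIdeal.mul_mem_left _ hpv) (v.asIdeal.mul_mem_left _ h)
  exact v.isPrime.ne_top ((Ideal.eq_top_iff_one _).mpr h1)

/-- **The primary generator of an inert prime is `−p`** (`p ≡ 2 (mod 3)`). [cite: IrelandRosen1990, Ch. 9 §3] -/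
theorem primGen_span_natCast_of_mod_three_eq_two {p : ℕ} (hp3 : p % 3 = 2) :
    primGen (Ideal.span {((p : ℤ) : 𝓞 K3)}) = -((p : ℤ) : 𝓞 K3) := by
  have h1 : -((p : ℤ) : 𝓞 K3) - 1 ∈ three := by
    set k : ℕ := (p + 1) / 3 with hk
    have h3 : 3 * k = p + 1 := Nat.mul_div_cancel' (by omega)
    have h3' : (-(k : ℤ)) * 3 = -(p : ℤ) - 1 := by
      have : (3 : ℤ) * k = p + 1 := by exact_mod_cast h3
      linarith
    refine Ideal.mem_span_singleton'.mpr ⟨((-(k : ℤ) : ℤ) : 𝓞 K3), ?_⟩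
    have e := congrArg (Int.cast : ℤ → 𝓞 K3) h3'
    push_cast at e ⊢
    exact e
  refine primGen_eq_of ?_ ?_ h1
  · exact isCoprime_three_of_sub_one_mem h1 |> fun h ↦ by rwa [Ideal.span_singleton_neg] at h
  · exact Ideal.span_singleton_neg _

/-- `N((p)) = p²`. [folklore] -/
theorem absNorm_span_natCast (p : ℕ) : Ideal.absNorm (Ideal.span {((p : ℤ) : 𝓞 K3)}) = p ^ 2 := by
  rw [← mkInt_intCast, absNorm_span_mkInt]
  simp [sq, Int.natAbs_mul]

/-- `e(−p)/|e(−p)|` is `−1`, so the sector weight of `−p` is `(−1)^m`. [folklore] -/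
theorem sectorWeight_embC_neg_natCast {p : ℕ} (hp : 0 < p) (m : ℕ) :
    sectorWeight m (embC ((-((p : ℤ) : 𝓞 K3) : 𝓞 K3) : K3)) = (-1) ^ m := by
  unfold sectorWeight
  have e : embC ((-((p : ℤ) : 𝓞 K3) : 𝓞 K3) : K3) = -(p : ℂ) := by
    push_cast
    rw [map_neg, map_natCast]
  rw [e, norm_neg, Complex.norm_natCast, Complex.ofReal_natCast]
  have hp' : (p : ℂ) ≠ 0 := by exact_mod_cast hp.ne'
  rw [neg_div, div_self hp']

/-- `(3) ∉ v` for a prime `v` above `p ≠ 3`. [folklore] -/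
theorem three_not_mem {v : HeightOneSpectrum (𝓞 K3)} {p : ℕ} (hp : p.Prime) (hp3 : p ≠ 3)
    (hpv : ((p : ℤ) : 𝓞 K3) ∈ v.asIdeal) : (3 : 𝓞 K3) ∉ v.asIdeal := by
  have h := intCast_not_mem hp hpv (n := 3) (by
    intro hd
    have : p ∣ 3 := by exact_mod_cast hd
    rcases (Nat.dvd_prime Nat.prime_three).mp this with h1 | h1
    · exact hp.ne_one h1
    · exact hp3 h1)
  have e3 : ((3 : ℤ) : 𝓞 K3) = 3 := by simp
  rwa [e3] at h

/-- **The cubic residue symbol of a rational integer at an inert prime is `1`**: for `p ≡ 2 (mod 3)`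
odd and `p ∤ d`, `χ_{(p)}(d) = 1` (`d^{(p²−1)/3} = (d^{p−1})^{(p+1)/3} ≡ 1`).
[cite: IrelandRosen1990, Ch. 9 §3 Prop. 9.3.3] -/
theorem cubicResidueSymbol_inert_intCast {p : ℕ} (hp : p.Prime) (hp3 : p % 3 = 2) (hp2 : p ≠ 2)
    {d : ℤ} (hd : ¬ (p : ℤ) ∣ d) :
    cubicResidueSymbol (primeOf (prime_natCast_of_mod_three_eq_two hp hp3))
      (Ideal.Quotient.mk _ ((d : ℤ) : 𝓞 K3)) = 1 := by
  set v := primeOf (prime_natCast_of_mod_three_eq_two hp hp3) with hv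
  haveI : Fact p.Prime := ⟨hp⟩
  have hpv : ((p : ℤ) : 𝓞 K3) ∈ v.asIdeal := Ideal.mem_span_singleton_self _
  have hpv' : (p : 𝓞 K3) ∈ v.asIdeal := by rwa [Int.cast_natCast] at hpv
  have h3v : (3 : 𝓞 K3) ∉ v.asIdeal := three_not_mem hp (by omega) hpv
  refine cubicResidueSymbol_eq_of_pow_three_eq_one hζ h3v (μ := 1) (one_pow 3) ?_
  rw [map_one]
  -- the exponent `(N v − 1)/3 = (p − 1)·((p + 1)/3)`
  have hN : v.residueCard = p ^ 2 := by
    show Ideal.absNorm v.asIdeal = p ^ 2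
    rw [hv, primeOf_asIdeal, absNorm_span_natCast]
  set k : ℕ := (p + 1) / 3 with hk
  have hexp : (v.residueCard - 1) / 3 = (p - 1) * k := by
    rw [hN]
    have h3 : 3 * k = p + 1 := Nat.mul_div_cancel' (by omega)
    have hp1 : 1 ≤ p := hp.one_lt.le
    refine Nat.div_eq_of_eq_mul_left (by norm_num) ?_
    zify [hp1, Nat.one_le_pow 2 p hp.pos]
    have h3' : (3 : ℤ) * k = p + 1 := by exact_mod_cast h3
    linear_combination (-((p : ℤ) - 1)) * h3'
  rw [hexp, pow_mul]
  -- Fermat: `d^{p-1} ≡ 1`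
  have hfermat : (Ideal.Quotient.mk v.asIdeal ((d : ℤ) : 𝓞 K3)) ^ (p - 1) = 1 := by
    obtain ⟨n, rfl | rfl⟩ := Int.eq_nat_or_neg d
    · have hn : ¬ p ∣ n := fun h ↦ hd (by exact_mod_cast h)
      have := natCast_pow_sub_one_eq_one (K := K3) hpv' hn
      rw [Int.cast_natCast, map_natCast]
      exact this
    · have hn : ¬ p ∣ n := fun h ↦ hd (by rw [Int.dvd_neg]; exact_mod_cast h)
      have h1 := natCast_pow_sub_one_eq_one (K := K3) hpv' hn
      have heven : Even (p - 1) := hp.even_sub_one hp2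
      rw [Int.cast_neg, Int.cast_natCast, map_neg, map_natCast, heven.neg_pow]
      exact h1
  rw [hfermat, one_pow]

/-- **The value of `ν_{d,r,m}` at an inert prime**: `ν((p)) = (−1)^m` for `p ≡ 2 (mod 3)` odd with
`p ∤ 3d`. [cite: IrelandRosen1990, Ch. 18 §6, proof of Theorem 7] -/
theorem grossenNu_span_natCast_of_mod_three_eq_two {p : ℕ} (hp : p.Prime) (hp3 : p % 3 = 2)
    (hp2 : p ≠ 2) {d : ℤ} (hd : ¬ (p : ℤ) ∣ 3 * d) (r m : ℕ) :
    grossenNu ((d : ℤ) : 𝓞 K3) r m (Ideal.span {((p : ℤ) : 𝓞 K3)}) = (-1) ^ m := by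
  set v := primeOf (prime_natCast_of_mod_three_eq_two hp hp3) with hv
  have hpv : ((p : ℤ) : 𝓞 K3) ∈ v.asIdeal := Ideal.mem_span_singleton_self _
  have hdd : ¬ (p : ℤ) ∣ d := fun h ↦ hd (dvd_mul_of_dvd_right h 3)
  have hDv : ((d : ℤ) : 𝓞 K3) ∉ v.asIdeal := intCast_not_mem hp hpv hdd
  have h3v : (3 : 𝓞 K3) ∉ v.asIdeal := three_not_mem hp (by omega) hpv
  have h3D : 3 * ((d : ℤ) : 𝓞 K3) ∉ v.asIdeal := by
    have := intCast_not_mem hp hpv hd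
    push_cast at this
    exact this
  have hadm : Adm ((d : ℤ) : 𝓞 K3) v.asIdeal := adm_of_not_mem _ v h3D
  have h := grossenNu_asIdeal_eq ((d : ℤ) : 𝓞 K3) r m v hDv h3v hadm
  change grossenNu ((d : ℤ) : 𝓞 K3) r m v.asIdeal = _
  rw [h, hv, cubicResidueSymbol_inert_intCast hp hp3 hp2 hdd]
  simp only [map_one, one_pow, one_mul, primeOf_asIdeal]
  rw [primGen_span_natCast_of_mod_three_eq_two hp3, sectorWeight_embC_neg_natCast hp.pos]

end IntParam

/-! ### Complex conjugation: `τ` on `𝓞 K3`, conjugate primes, and `ν(τ v) = conj ν(v)` -/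

section Conj

/-- **Complex conjugation on `𝓞 K3`** (`ζ ↦ ζ̄ = ζ²`), the restriction of `K3.conj`. [folklore] -/
def tau : 𝓞 K3 ≃+* 𝓞 K3 := RingOfIntegers.mapRingEquiv K3.conj

/-- `τ` in coordinates: `τ(a + bζ) = (a − b) − bζ`. [folklore] -/
theorem tau_mkInt (a b : ℤ) : tau (mkInt a b) = mkInt (a - b) (-b) := by
  apply RingOfIntegers.ext
  rw [tau, RingOfIntegers.mapRingEquiv_apply, coe_mkInt, coe_mkInt, conj_apply, QuadraticAlgebra.star_mk]
  congr 1; push_cast; ring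

/-- `τ` on the underlying field element. [folklore] -/
theorem coe_tau (y : 𝓞 K3) : ((tau y : 𝓞 K3) : K3) = star (y : K3) := by
  rw [tau, RingOfIntegers.mapRingEquiv_apply, conj_apply]

/-- `τ` fixes the rational integers. [folklore] -/
theorem tau_intCast (n : ℤ) : tau (n : 𝓞 K3) = n := map_intCast _ n

/-- `τ 3 = 3`. [folklore] -/
theorem tau_three : tau (3 : 𝓞 K3) = 3 := by
  have h := tau_intCast 3
  have e3 : ((3 : ℤ) : 𝓞 K3) = 3 := by simp
  rwa [e3] at h

/-- `τ` is an involution. [folklore] -/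
theorem tau_tau (y : 𝓞 K3) : tau (tau y) = y := by
  obtain ⟨a, b, rfl⟩ := exists_eq_mkInt y
  rw [tau_mkInt, tau_mkInt]; congr 1 <;> ring

/-- `conj w = −1 − w` (`= w̄ = w²`). [folklore] -/
theorem conj_w : conj w = -1 - w := by
  apply Complex.ext <;> simp [w]; norm_num

/-- **`e ∘ star = conj ∘ e`** on `K3`. [folklore] -/
theorem embC_star (x : K3) : embC (star x) = conj (embC x) := by
  obtain ⟨a, b⟩ := x
  rw [QuadraticAlgebra.star_mk, embC_mk, embC_mk, map_add, map_mul, map_ratCast, map_ratCast, conj_w]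
  push_cast
  ring

/-- **`e(τ y) = conj e(y)`** for algebraic integers. [folklore] -/
theorem embC_tau (y : 𝓞 K3) : embC ((tau y : 𝓞 K3) : K3) = conj (embC (y : K3)) := by
  rw [coe_tau, embC_star]

/-- The sector weight commutes with conjugation. [folklore] -/
theorem sectorWeight_conj (m : ℕ) (z : ℂ) : sectorWeight m (conj z) = conj (sectorWeight m z) := by
  unfold sectorWeight
  rw [map_pow, map_div₀, Complex.conj_ofReal, Complex.norm_conj]

/-- `τ` maps `(3)` to `(3)` and preserves congruences modulo `3`. [folklore] -/
theorem tau_sub_one_mem_three {α : 𝓞 K3} (h : α - 1 ∈ three) : tau α - 1 ∈ three := by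
  obtain ⟨c, hc⟩ := Ideal.mem_span_singleton'.mp h
  refine Ideal.mem_span_singleton'.mpr ⟨tau c, ?_⟩
  have := congrArg tau hc
  rw [map_mul, map_sub, map_one, tau_three] at this
  exact this

/-- The image of an ideal under `τ`. [folklore] -/
theorem map_tau_span (α : 𝓞 K3) : Ideal.map tau (Ideal.span {α}) = Ideal.span {tau α} := by
  rw [Ideal.map_span, Set.image_singleton]

/-- `τ` preserves coprimality with `(3)`. [folklore] -/
theorem isCoprime_map_tau {I : Ideal (𝓞 K3)} (h : IsCoprime I three) : IsCoprime (Ideal.map tau I) three := by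
  have h3 : Ideal.map tau three = three := by
    rw [map_tau_span, tau_three]
  rw [Ideal.isCoprime_iff_sup_eq] at h ⊢
  rw [← h3, ← Ideal.map_sup, h, Ideal.map_top]

/-- **`τ` of a primary generator is the primary generator of the conjugate ideal.** [folklore] -/
theorem primGen_map_tau {I : Ideal (𝓞 K3)} (hI : IsCoprime I three) :
    primGen (Ideal.map tau I) = tau (primGen I) := by
  refine primGen_eq_of (isCoprime_map_tau hI) ?_ (tau_sub_one_mem_three (primGen_sub_one_mem hI))
  rw [← map_tau_span, span_primGen hI]

/-- **The conjugate prime** `τ v`. [folklore] -/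
def conjPrime (v : HeightOneSpectrum (𝓞 K3)) : HeightOneSpectrum (𝓞 K3) :=
  ⟨Ideal.map tau v.asIdeal, Ideal.map_isPrime_of_equiv tau,
    by rw [Ne, Ideal.map_eq_bot_iff_of_injective tau.injective]; exact v.ne_bot⟩

/-- Its ideal. [folklore] -/
@[simp] theorem conjPrime_asIdeal (v : HeightOneSpectrum (𝓞 K3)) : (conjPrime v).asIdeal = Ideal.map tau v.asIdeal :=
  rfl

/-- Membership in the conjugate prime. [folklore] -/
theorem mem_conjPrime_iff (v : HeightOneSpectrum (𝓞 K3)) (x : 𝓞 K3) :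
    x ∈ (conjPrime v).asIdeal ↔ tau x ∈ v.asIdeal := by
  rw [conjPrime_asIdeal, Ideal.mem_map_of_equiv]
  constructor
  · rintro ⟨y, hy, rfl⟩
    rwa [tau_tau]
  · intro h
    exact ⟨tau x, h, tau_tau x⟩

/-- The conjugate prime of a principal prime. [folklore] -/
theorem conjPrime_primeOf {q : 𝓞 K3} (hq : Prime q) (hq' : Prime (tau q)) :
    conjPrime (primeOf hq) = primeOf hq' :=
  HeightOneSpectrum.ext (by rw [conjPrime_asIdeal, primeOf_asIdeal, primeOf_asIdeal, map_tau_span])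

/-- **The residue fields of `v` and `τ v` have the same size.** [folklore] -/
theorem residueCard_conjPrime (v : HeightOneSpectrum (𝓞 K3)) : (conjPrime v).residueCard = v.residueCard := by
  show Ideal.absNorm (conjPrime v).asIdeal = Ideal.absNorm v.asIdeal
  rw [Ideal.absNorm_apply, Ideal.absNorm_apply, Submodule.cardQuot_apply, Submodule.cardQuot_apply]
  exact Nat.card_congr (Ideal.quotientEquiv v.asIdeal (conjPrime v).asIdeal tau rfl).toEquiv.symm

/-- **Naturality of the cubic residue symbol under conjugation**:
`χ_{τv}(τ x) = τ(χ_v(x))`. [cite: IrelandRosen1990, Ch. 9 §3 Prop. 9.3.4] -/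
theorem cubicResidueSymbol_conjPrime (v : HeightOneSpectrum (𝓞 K3)) (h3v : (3 : 𝓞 K3) ∉ v.asIdeal)
    (x : 𝓞 K3) :
    cubicResidueSymbol (conjPrime v) (Ideal.Quotient.mk (conjPrime v).asIdeal (tau x)) =
      tau (cubicResidueSymbol v (Ideal.Quotient.mk v.asIdeal x)) := by
  have h3v' : (3 : 𝓞 K3) ∉ (conjPrime v).asIdeal := by
    rw [mem_conjPrime_iff, tau_three]; exact h3v
  by_cases hx : x ∈ v.asIdeal
  · have h0 : Ideal.Quotient.mk v.asIdeal x = 0 := Ideal.Quotient.eq_zero_iff_mem.mpr hx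
    have h0' : Ideal.Quotient.mk (conjPrime v).asIdeal (tau x) = 0 := by
      rw [Ideal.Quotient.eq_zero_iff_mem, mem_conjPrime_iff, tau_tau]; exact hx
    rw [h0, h0', cubicResidueSymbol_zero hζ, cubicResidueSymbol_zero hζ, map_zero]
  · have hx0 : Ideal.Quotient.mk v.asIdeal x ≠ 0 := fun h ↦ hx (Ideal.Quotient.eq_zero_iff_mem.mp h)
    obtain ⟨hcube, hcong⟩ := cubicResidueSymbol_spec hζ h3v hx0
    refine cubicResidueSymbol_eq_of_pow_three_eq_one hζ h3v' (by rw [← map_pow, hcube, map_one]) ?_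
    rw [residueCard_conjPrime, ← map_pow, Ideal.Quotient.eq, mem_conjPrime_iff, map_sub, tau_tau,
      ← map_pow, tau_tau]
    rw [← map_pow, Ideal.Quotient.eq] at hcong
    exact hcong

variable (d : ℤ) (r m : ℕ)

/-- Admissibility is invariant under conjugation (`d ∈ ℤ`). [folklore] -/
theorem adm_conjPrime_iff (v : HeightOneSpectrum (𝓞 K3)) :
    Adm ((d : ℤ) : 𝓞 K3) (conjPrime v).asIdeal ↔ Adm ((d : ℤ) : 𝓞 K3) v.asIdeal := by
  have key : ∀ w : HeightOneSpectrum (𝓞 K3), Adm ((d : ℤ) : 𝓞 K3) w.asIdeal ↔ 3 * ((d : ℤ) : 𝓞 K3) ∉ w.asIdeal := by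
    intro w
    refine ⟨fun h hmem ↦ ?_, fun h ↦ adm_of_not_mem _ w h⟩
    have := grossenNu_asIdeal_eq_zero_of_mem ((d : ℤ) : 𝓞 K3) 0 0 w hmem
    rw [grossenNu_apply, if_pos h] at this
    simp [sectorWeight] at this
  rw [key, key, mem_conjPrime_iff, map_mul, tau_intCast, tau_three]

/-- **`ν_{d,r,m}(τ v) = conj ν_{d,r,m}(v)`** at every prime, for an integer parameter `d`.
[cite: HeckeMathZ1920, §6] -/
theorem grossenNu_conjPrime (v : HeightOneSpectrum (𝓞 K3)) :
    grossenNu ((d : ℤ) : 𝓞 K3) r m (conjPrime v).asIdeal = conj (grossenNu ((d : ℤ) : 𝓞 K3) r m v.asIdeal) := by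
  by_cases hadm : Adm ((d : ℤ) : 𝓞 K3) v.asIdeal
  swap
  · rw [grossenNu_apply, if_neg (mt (adm_conjPrime_iff d v).mp hadm), grossenNu_apply, if_neg hadm, map_zero]
  have hadm' := (adm_conjPrime_iff d v).mpr hadm
  -- `3 ∉ v`, `d ∉ v`
  have h3d : 3 * ((d : ℤ) : 𝓞 K3) ∉ v.asIdeal := by
    intro hmem
    have := grossenNu_asIdeal_eq_zero_of_mem ((d : ℤ) : 𝓞 K3) 0 0 v hmem
    rw [grossenNu_apply, if_pos hadm] at this
    simp [sectorWeight] at this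
  have h3v : (3 : 𝓞 K3) ∉ v.asIdeal := fun h ↦ h3d (v.asIdeal.mul_mem_right _ h)
  have hdv : ((d : ℤ) : 𝓞 K3) ∉ v.asIdeal := fun h ↦ h3d (v.asIdeal.mul_mem_left _ h)
  have h3v' : (3 : 𝓞 K3) ∉ (conjPrime v).asIdeal := by
    rw [mem_conjPrime_iff, tau_three]; exact h3v
  have hdv' : ((d : ℤ) : 𝓞 K3) ∉ (conjPrime v).asIdeal := by
    rw [mem_conjPrime_iff, tau_intCast]; exact hdv
  have hpg : primGen (conjPrime v).asIdeal = tau (primGen v.asIdeal) := primGen_map_tau hadm.coprime_three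
  have hchi : cubicResidueSymbol (conjPrime v) (Ideal.Quotient.mk (conjPrime v).asIdeal ((d : ℤ) : 𝓞 K3)) =
      tau (cubicResidueSymbol v (Ideal.Quotient.mk v.asIdeal ((d : ℤ) : 𝓞 K3))) := by
    have := cubicResidueSymbol_conjPrime v h3v ((d : ℤ) : 𝓞 K3)
    rwa [tau_intCast] at this
  rw [grossenNu_asIdeal_eq _ r m v hdv h3v hadm, grossenNu_asIdeal_eq _ r m (conjPrime v) hdv' h3v' hadm',
    map_mul, map_pow, hpg, hchi, embC_tau, embC_tau, sectorWeight_conj]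

end Conj


/-! ### The local factors `G_p(s) = ∏_{v ∣ p} (1 − ν(v) N(v)^{−s})⁻¹` of `L(s, ν_{d,r,m})` -/

section LocalFactors

variable (d : ℤ) (r m : ℕ)

/-- The local factor of `L(s, ν)` at the rational prime `p`. [cite: IrelandRosen1990, Ch. 18 §6] -/
def localFactor (p : ℕ) (s : ℂ) : ℂ :=
  ∏ v ∈ primesOver p, (1 - grossenNu ((d : ℤ) : 𝓞 K3) r m v.asIdeal * ((Ideal.absNorm v.asIdeal : ℕ) : ℂ) ^ (-s))⁻¹

/-- **`L(s, ν_{d,r,m}) = ∏_p G_p(s)`** (`Re s > 1`). [cite: IrelandRosen1990, Ch. 18 §6, proof of Theorem 7] -/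
theorem hasProd_localFactor {s : ℂ} (hs : 1 < s.re) :
    HasProd (fun p : Nat.Primes ↦ localFactor d r m p s)
      (LSeries (twistCount K3 (grossenNu ((d : ℤ) : 𝓞 K3) r m)) s) :=
  hasProd_primes_LSeries_twistCount _ (norm_grossenNu_le _ r m) hs

/-- **Bad primes**: `G_p = 1` for `p ∣ 3d` (every prime above `p` contains `3d`, so `ν` vanishes there).
[folklore] -/
theorem localFactor_of_dvd {p : ℕ} (hp : p.Prime) (hpd : (p : ℤ) ∣ 3 * d) (s : ℂ) :
    localFactor d r m p s = 1 := by
  refine Finset.prod_eq_one fun v hv ↦ ?_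
  rw [mem_primesOver hp] at hv
  have hmem : 3 * ((d : ℤ) : 𝓞 K3) ∈ v.asIdeal := by
    have h := Ideal.mul_mem_left v.asIdeal (((3 * d / p : ℤ) : ℤ) : 𝓞 K3) hv
    have e : (((3 * d / p : ℤ) : ℤ) : 𝓞 K3) * ((p : ℤ) : 𝓞 K3) = 3 * ((d : ℤ) : 𝓞 K3) := by
      have := Int.ediv_mul_cancel hpd
      have h' := congrArg (Int.cast : ℤ → 𝓞 K3) this
      push_cast at h' ⊢
      exact h'
    rwa [e] at h
  rw [grossenNu_asIdeal_eq_zero_of_mem _ r m v hmem, zero_mul, sub_zero, inv_one]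

/-- **Inert primes**: `G_p(s) = (1 − (−1)^m p^{−2s})⁻¹` for `p ≡ 2 (mod 3)`, `p ≠ 2`, `p ∤ 3d`.
[cite: IrelandRosen1990, Ch. 18 §6, proof of Theorem 7] -/
theorem localFactor_of_mod_three_eq_two {p : ℕ} (hp : p.Prime) (hp3 : p % 3 = 2) (hp2 : p ≠ 2)
    (hpd : ¬ (p : ℤ) ∣ 3 * d) (s : ℂ) :
    localFactor d r m p s = (1 - (-1) ^ m * ((p : ℂ) ^ 2) ^ (-s))⁻¹ := by
  rw [localFactor, primesOver_of_mod_three_eq_two hp hp3, Finset.prod_singleton, primeOf_asIdeal,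
    grossenNu_span_natCast_of_mod_three_eq_two hp hp3 hp2 hpd, absNorm_span_natCast]
  push_cast
  ring

open Classical in
/-- **Split primes: the data.** For `p ≡ 1 (mod 3)` there are a prime `v` of `𝓞 K3` above `p` of
degree `1` with primary generator `ϖ` (`‖e(ϖ)‖² = p`), such that the primes above `p` are exactly
`v ≠ τ v`, and for every integer `d` with `p ∤ 3d`:
`ν_{d,r,m}(v) = e(χ_v(d))^r (e(ϖ)/|e(ϖ)|)^m` and `ν_{d,r,m}(τ v) = conj ν_{d,r,m}(v)`.
[cite: IrelandRosen1990, Ch. 18 §6, proof of Theorem 7] -/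
theorem exists_split_data {p : ℕ} (hp : p.Prime) (hp3 : p % 3 = 1) :
    ∃ (v : HeightOneSpectrum (𝓞 K3)) (ϖ : 𝓞 K3),
      v ≠ conjPrime v ∧ primesOver p = {v, conjPrime v} ∧
      ((p : ℤ) : 𝓞 K3) ∈ v.asIdeal ∧ v.residueCard = p ∧ (conjPrime v).residueCard = p ∧
      Ideal.span {ϖ} = v.asIdeal ∧ ϖ - 1 ∈ three ∧ ‖embC (ϖ : K3)‖ ^ 2 = p ∧
      ∀ (d : ℤ) (r m : ℕ), ¬ (p : ℤ) ∣ 3 * d →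
        grossenNu ((d : ℤ) : 𝓞 K3) r m v.asIdeal =
          embC ((cubicResidueSymbol v (Ideal.Quotient.mk v.asIdeal ((d : ℤ) : 𝓞 K3)) : 𝓞 K3) : K3) ^ r *
            sectorWeight m (embC (ϖ : K3)) := by
  obtain ⟨a, b, h, hq, hq', hne, hfac⟩ := exists_split_of_mod_three_eq_one hp hp3
  have htau : tau (mkInt a b) = mkInt (a - b) (-b) := tau_mkInt a b
  have hq'' : Prime (tau (mkInt a b)) := by rw [htau]; exact hq'
  set v := primeOf hq with hv
  have hconj : conjPrime v = primeOf hq' := by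
    rw [hv, conjPrime_primeOf hq hq'']
    exact HeightOneSpectrum.ext (by rw [primeOf_asIdeal, primeOf_asIdeal, htau])
  have hpv : ((p : ℤ) : 𝓞 K3) ∈ v.asIdeal := by
    rw [hv, primeOf_asIdeal]
    have : ((p : ℤ) : 𝓞 K3) ∈ Ideal.span {mkInt a b} * Ideal.span {mkInt (a - b) (-b)} := by
      rw [← hfac]; exact Ideal.mem_span_singleton_self _
    exact Ideal.mul_le_right this
  have hp3' : p ≠ 3 := by omega
  have h3v : (3 : 𝓞 K3) ∉ v.asIdeal := three_not_mem hp hp3' hpv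
  have hcop : IsCoprime v.asIdeal three := (adm_of_not_mem 1 v (by rw [mul_one]; exact h3v)).coprime_three
  have hN : v.residueCard = p := by
    show Ideal.absNorm v.asIdeal = p
    rw [hv, primeOf_asIdeal, absNorm_span_mkInt, h, Int.natAbs_natCast]
  refine ⟨v, primGen v.asIdeal, ?_, ?_, hpv, hN, by rw [residueCard_conjPrime, hN], span_primGen hcop,
    primGen_sub_one_mem hcop, ?_, ?_⟩
  · rw [hconj, hv]
    intro heq
    exact hne (by rw [← primeOf_asIdeal hq, ← primeOf_asIdeal hq', heq])
  · rw [hconj, hv]; exact primesOver_of_norm_eq hp h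
  · rw [← absNorm_span_singleton_eq, span_primGen hcop]
    have : ((Ideal.absNorm v.asIdeal : ℕ) : ℝ) = p := by
      have h' : Ideal.absNorm v.asIdeal = p := hN
      rw [h']
    exact this
  · intro d r m hpd
    have hdd : ¬ (p : ℤ) ∣ d := fun h' ↦ hpd (dvd_mul_of_dvd_right h' 3)
    have hDv : ((d : ℤ) : 𝓞 K3) ∉ v.asIdeal := intCast_not_mem hp hpv hdd
    have h3D : 3 * ((d : ℤ) : 𝓞 K3) ∉ v.asIdeal := by
      have := intCast_not_mem hp hpv hpd
      push_cast at this
      exact this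
    exact grossenNu_asIdeal_eq _ r m v hDv h3v (adm_of_not_mem _ v h3D)

open Classical in
/-- **Split primes: the local factor** `G_p(s) = (1 − ν(v)p^{−s})⁻¹(1 − conj(ν(v)) p^{−s})⁻¹` for
the degree-one prime `v` of `exists_split_data`. [cite: IrelandRosen1990, Ch. 18 §6, proof of Theorem 7] -/
theorem localFactor_of_split {p : ℕ} {v : HeightOneSpectrum (𝓞 K3)}
    (hne : v ≠ conjPrime v) (hover : primesOver p = {v, conjPrime v}) (hN : v.residueCard = p) (s : ℂ) :
    localFactor d r m p s =
      (1 - grossenNu ((d : ℤ) : 𝓞 K3) r m v.asIdeal * (p : ℂ) ^ (-s))⁻¹ *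
        (1 - conj (grossenNu ((d : ℤ) : 𝓞 K3) r m v.asIdeal) * (p : ℂ) ^ (-s))⁻¹ := by
  classical
  have hN' : (conjPrime v).residueCard = p := by rw [residueCard_conjPrime, hN]
  rw [localFactor, hover, Finset.prod_pair hne, grossenNu_conjPrime]
  have e1 : Ideal.absNorm v.asIdeal = p := hN
  have e2 : Ideal.absNorm (conjPrime v).asIdeal = p := hN'
  rw [e1, e2]

end LocalFactors

end Literature.NumberTheory.LFunctions.EisensteinGrossen

end
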